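import Mathlib.Analysis.Calculus.MeanValue
import Summits.QuantumFields.YangMills.Theorems.BalabanUVNodesN08HaarCompatibilityGuardJacobianContractionDet
import Summits.QuantumFields.YangMills.Theorems.ReplicaVarianceTiltHeightChiSqLEmlDContinuous

/-!
# BalabanUVNodes ∕ N08 — (E4) WITHOUT COERCIVITY (part 4): on a convex window a map whose derivative stays `ε`-close to ONE linear map `L`
# with `λ‖v‖ ≤ ‖Lv‖`, `ε < λ`, is `(λ − ε)`-EXPANDING and INJECTIVE; and the printed fibre map is `C^∞` on the guard, its tangent map
# `W ↦ D K_W` varying CONTINUOUSLY — so such windows exist around every guarded point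

WIDTH SEAT `pub-ymgap-dag-n08-w6` g4 (R399 (3a) second wave; CLAIM-3 ∕ INTENT-4 of record on HOME INBOX, successor of CLAIM-1∕2 = p616149 ✓ p617624 ✓
p619392 ✓ p620432 ✓ (+ part 3c)), 2026-08-28.  Track A, DAG node N08 = [Balaban1985UV3] Thm 1 p. 257 (compact) + Thm 2 p. 272; key item K1⁷
`StabilityBAtRecordR13SepCoPH` (stmt-QuantumFields-20542), `--supports … --as helper`.  COUNT-NEUTRAL.

THE POINT.  Sibling n08-w3's one-window engine frame (p616325 `…GuardChartTransfer`, p618018 `…GuardCoerciveWindows`, parts 21∕22∕25) reduces the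
fibre-law hypothesis (H_K) at `N = 2` to windows on which the chart conjugate of the printed fibre map `K_W = exp(Σᵢcᵢ log(hᵢW*))·W` is INJECTIVE with
a Jacobian floor; its (E4) route to injectivity (`injOn_of_coercive`) asks the derivative to be `c`-COERCIVE, `c‖v‖² ≤ ⟪f′(z)v, v⟫`.  What this lineage
PROVES about the tangent map is a SINGULAR-VALUE floor (`(1 − Σcᵢ)‖X‖ ≤ ‖D K_W(WX)‖_HS`, g3's p612264; determinant form p616149∕p617624) — and the
left-trivialised tangent map is NOT `(1 − Σcᵢ)`-coercive in general (this seat's numerics, session `work/numerics/coercive_hill.py`: the least eigenvalue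
of its hs-symmetric part over `1 − Σcᵢ` is ≈ 0.98 for `1 − Σcᵢ ≳ 0.05` but 0.52 at `1 − Σcᵢ = 10⁻³`; evidence only).  Injectivity on windows does NOT
need coercivity: the inverse-function-theorem argument needs only the singular-value floor of ONE linear map `L` (the tangent map at the window's
centre) and the OSCILLATION `‖f′(z) − L‖ ≤ ε < λ` over a convex window.  This file banks that route:
* §1 [folklore] ★ `mul_norm_sub_le_norm_sub` (`(λ − ε)‖y − x‖ ≤ ‖f y − f x‖`), ★★ `injOn_of_norm_fderiv_sub_le` (injective on the convex window),
  `norm_sub_le_mul_norm_sub` (`≤ (‖L‖ + ε)‖y − x‖`), `exists_ball_norm_sub_le` (windows from continuity of `z ↦ f′(z)`) — Mathlib's mean-value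
  inequality `Convex.norm_image_sub_le_of_norm_hasFDerivWithin_le'` for `f − L`; any real normed spaces.
* §2 ★ `contDiffAt_kmat`: `Kmat h c` is `C^∞` (real) at every point of the open guard `‖hᵢM* − 1‖ < 1` (pub-balaban's `analyticAt_mlog`, Mathlib's
  `NormedSpace.exp_analytic`); `fderiv_kmat_eq_emlD`; `eventually_guard`; ★★ `continuousAt_emlD` — THE TANGENT MAP `W ↦ emlD h c W` IS CONTINUOUS at
  guarded points (operator norm); `exists_ball_norm_emlD_sub_le` (ε–r form); `continuousAt_kmat`; ★ `continuousAt_leftTrivialised`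
  (`W ↦ K_W*·D K_W` continuous as well).
HOW IT IS MEANT TO BE USED (located; the chart composition is n08-w3's (E3) and is NOT typed here): at a window centre `W₀` take `L :=` the chart expression
of `D K_{W₀}` (floor `λ = 1 − Σcᵢ` up to the chart distortion, p612264∕p616149), shrink the window until the chart derivative oscillates by `ε < λ`
(§2 + smoothness of the chart), conclude injectivity and `(λ − ε)`-expansion on the window by §1, and feed part 21's frame; the window NUMBER then comes
from compactness (n08-w3's `exists_finset_cover_balls`) — qualitative, which is all (H_K)'s `∃ K` asks.

HONEST FRAMING.  Count-neutral helper ([folklore] calculus; §2 is bookkeeping over pub-balaban's `Kmat`∕`emlD`); NO chart composition, NO window count, NO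
density bound typed; nothing of Bałaban's asserted; (H_K) NOT discharged; E6′ NOT decided; `hmass` NOT supplied; N08 NOT discharged; counts unmoved (typed 28∕28 ·
discharged 5∕27); no summit statement is proved by this seat — one finite 𝕋⁴ programme at fixed ε, R4 closes the CONDITIONAL rung `BalabanLadder.UV` only; the
Yang–Mills mass gap (Clay) is NOT proved by any of this; nothing continuum ∕ ℝ⁴ ∕ OS.  0 `sorry`, 0 `def`, 0 `instance`, 0 `notation`, standard axioms.
-/

noncomputable section

open Set NormedSpace Filter Metric
open scoped Topology Matrix Matrix.Norms.L2Operator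

namespace Summit.QuantumFields.YangMills.BalabanUVNodes.N08HaarCompatibilityGuardWindowInjective

/-! ## §1 [folklore] Injectivity on a convex window from a singular-value floor of ONE linear map and the oscillation of the derivative -/

section Window

variable {E F : Type*} [NormedAddCommGroup E] [NormedSpace ℝ E] [NormedAddCommGroup F] [NormedSpace ℝ F]

/-- **Expansion on a convex window.**  `f` differentiable within a convex `s` with `‖f′(z) − L‖ ≤ ε` on `s`, and `λ‖v‖ ≤ ‖L v‖` for all `v`:
then `(λ − ε)·‖y − x‖ ≤ ‖f y − f x‖` for `x, y ∈ s` — the mean-value inequality for `f − L` (Mathlib's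
`Convex.norm_image_sub_le_of_norm_hasFDerivWithin_le'`) and the reverse triangle inequality.  NO coercivity (numerical-range) hypothesis on
`L` or `f′` is needed — only the singular-value floor of ONE linear map and the oscillation of the derivative over the window. [folklore] -/
theorem mul_norm_sub_le_norm_sub {f : E → F} {f' : E → E →L[ℝ] F} {s : Set E} (hs : Convex ℝ s)
    (hf : ∀ z ∈ s, HasFDerivWithinAt f (f' z) s z) (L : E →L[ℝ] F) {l ε : ℝ} (hL : ∀ v, l * ‖v‖ ≤ ‖L v‖)
    (hε : ∀ z ∈ s, ‖f' z - L‖ ≤ ε) {x y : E} (hx : x ∈ s) (hy : y ∈ s) :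
    (l - ε) * ‖y - x‖ ≤ ‖f y - f x‖ := by
  have hmv : ‖f y - f x - L (y - x)‖ ≤ ε * ‖y - x‖ := hs.norm_image_sub_le_of_norm_hasFDerivWithin_le' hf hε hx hy
  have h1 : l * ‖y - x‖ ≤ ‖L (y - x)‖ := hL (y - x)
  have h2 : ‖L (y - x)‖ - ‖f y - f x‖ ≤ ‖L (y - x) - (f y - f x)‖ := norm_sub_norm_le _ _
  have h3 : ‖L (y - x) - (f y - f x)‖ = ‖f y - f x - L (y - x)‖ := by rw [← norm_neg]; congr 1; abel
  linarith

/-- **Injectivity on a convex window** under the same hypotheses with `ε < λ`. [folklore] -/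
theorem injOn_of_norm_fderiv_sub_le {f : E → F} {f' : E → E →L[ℝ] F} {s : Set E} (hs : Convex ℝ s)
    (hf : ∀ z ∈ s, HasFDerivWithinAt f (f' z) s z) (L : E →L[ℝ] F) {l ε : ℝ} (hL : ∀ v, l * ‖v‖ ≤ ‖L v‖)
    (hε : ∀ z ∈ s, ‖f' z - L‖ ≤ ε) (hlε : ε < l) : InjOn f s := by
  intro x hx y hy hxy
  have h := mul_norm_sub_le_norm_sub hs hf L hL hε hx hy
  rw [hxy, sub_self, norm_zero] at h
  have h0 : ‖y - x‖ ≤ 0 := by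
    by_contra hcon
    push Not at hcon
    have := mul_pos (sub_pos.2 hlε) hcon
    linarith
  have := norm_le_zero_iff.1 h0
  exact (sub_eq_zero.1 this).symm

/-- **Lipschitz upper bound on the window**: `‖f y − f x‖ ≤ (‖L‖ + ε)·‖y − x‖`. [folklore] -/
theorem norm_sub_le_mul_norm_sub {f : E → F} {f' : E → E →L[ℝ] F} {s : Set E} (hs : Convex ℝ s)
    (hf : ∀ z ∈ s, HasFDerivWithinAt f (f' z) s z) (L : E →L[ℝ] F) {ε : ℝ}
    (hε : ∀ z ∈ s, ‖f' z - L‖ ≤ ε) {x y : E} (hx : x ∈ s) (hy : y ∈ s) :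
    ‖f y - f x‖ ≤ (‖L‖ + ε) * ‖y - x‖ := by
  have hmv : ‖f y - f x - L (y - x)‖ ≤ ε * ‖y - x‖ := hs.norm_image_sub_le_of_norm_hasFDerivWithin_le' hf hε hx hy
  have h1 : ‖L (y - x)‖ ≤ ‖L‖ * ‖y - x‖ := L.le_opNorm _
  have h2 : ‖f y - f x‖ ≤ ‖L (y - x)‖ + ‖f y - f x - L (y - x)‖ := by
    have := norm_add_le (L (y - x)) (f y - f x - L (y - x))
    rwa [add_sub_cancel] at this
  linarith

/-- **Windows exist where the derivative oscillates little**: if `z ↦ f′(z)` is continuous at `x₀` (operator norm), then for every `ε > 0` there is a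
ball around `x₀` on which `‖f′(z) − f′(x₀)‖ ≤ ε` — with `L := f′(x₀)` and `ε < λ` this is the window of the two lemmas above. [folklore] -/
theorem exists_ball_norm_sub_le {f' : E → E →L[ℝ] F} {x₀ : E} (hc : ContinuousAt f' x₀) {ε : ℝ} (hε : 0 < ε) :
    ∃ r > 0, ∀ z ∈ ball x₀ r, ‖f' z - f' x₀‖ ≤ ε := by
  rcases Metric.continuousAt_iff.1 hc ε hε with ⟨r, hr, h⟩
  exact ⟨r, hr, fun z hz => by rw [← dist_eq_norm]; exact (h hz).le⟩

end Window

/-! ## §2 The printed fibre map `K_M = exp(Σᵢ cᵢ log(hᵢ M*))·M` is `C^∞` on the guard; its tangent map varies continuously with the base point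
(pointwise-in-`W` corollaries of the JOINT statements of `…HeightChiSqLEmlDContinuous` — route ReplicaVarianceTilt, cited BY NAME, not restated) -/

section Smooth

open Literature.MathematicalPhysics.QuantumFieldTheory.Balaban1983to89
open Literature.MathematicalPhysics.QuantumFieldTheory.Balaban1983to89.T4EMLTangentInjective
open Literature.MathematicalPhysics.QuantumFieldTheory.Balaban1983to89.MatrixLog (mlog)
open Summit.QuantumFields.YangMills.Theorems.HeightChiSqLEmlDContinuous (isOpen_emlDomain analyticOnNhd_Kmat continuousOn_emlD)

variable {m : Type*} [Fintype m] [DecidableEq m] [Nonempty m] {ι : Type*} [Fintype ι]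

omit [Nonempty m] in
/-- **`Kmat h c` is real-analytic, hence `C^∞`, at every point of the open guard `‖hᵢ M* − 1‖ < 1`** — the fixed-`h` slice of the JOINT analyticity
`HeightChiSqLEmlDContinuous.analyticOnNhd_Kmat` (route ReplicaVarianceTilt), composed with the affine embedding `W ↦ (h, W)`. [folklore] -/
theorem analyticAt_kmat (h : ι → Matrix m m ℂ) (c : ι → ℝ) {W : Matrix m m ℂ} (hW : ∀ i, ‖h i * star W - 1‖ < 1) :
    AnalyticAt ℝ (Kmat h c) W := by
  have hmem : ((h, W) : (ι → Matrix m m ℂ) × Matrix m m ℂ) ∈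
      {p : (ι → Matrix m m ℂ) × Matrix m m ℂ | ∀ i, ‖p.1 i * star p.2 - 1‖ < 1} := hW
  have hj : AnalyticAt ℝ (fun p : (ι → Matrix m m ℂ) × Matrix m m ℂ => Kmat p.1 c p.2) (h, W) :=
    analyticOnNhd_Kmat (m := m) c (h, W) hmem
  have he : AnalyticAt ℝ (fun W' : Matrix m m ℂ => ((h, W') : (ι → Matrix m m ℂ) × Matrix m m ℂ)) W :=
    analyticAt_const.prod analyticAt_id
  have hc := AnalyticAt.comp (g := fun p : (ι → Matrix m m ℂ) × Matrix m m ℂ => Kmat p.1 c p.2)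
    (f := fun W' : Matrix m m ℂ => ((h, W') : (ι → Matrix m m ℂ) × Matrix m m ℂ)) (x := W) hj he
  exact hc

omit [Nonempty m] in
/-- `Kmat h c` is `C^n` at guarded points for every `n`. [folklore] -/
theorem contDiffAt_kmat (h : ι → Matrix m m ℂ) (c : ι → ℝ) {W : Matrix m m ℂ} (hW : ∀ i, ‖h i * star W - 1‖ < 1) {n : WithTop ℕ∞} :
    ContDiffAt ℝ n (Kmat h c) W :=
  (analyticAt_kmat h c hW).contDiffAt

/-- On the guard, `fderiv ℝ (Kmat h c) W = emlD h c W` (pub-balaban's explicit strict derivative). [folklore] -/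
theorem fderiv_kmat_eq_emlD (h : ι → Matrix m m ℂ) (c : ι → ℝ) {W : Matrix m m ℂ} (hW : ∀ i, ‖h i * star W - 1‖ < 1) :
    fderiv ℝ (Kmat h c) W = emlD h c W :=
  (hasStrictFDerivAt_Kmat h c hW).hasFDerivAt.fderiv

omit [Nonempty m] in
/-- The guard `‖hᵢ M* − 1‖ < 1` is an open condition: it holds for all `M` near `W`. [folklore] -/
theorem eventually_guard {h : ι → Matrix m m ℂ} {W : Matrix m m ℂ} (hW : ∀ i, ‖h i * star W - 1‖ < 1) :
    ∀ᶠ M in 𝓝 W, ∀ i, ‖h i * star M - 1‖ < 1 := by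
  refine eventually_all.2 fun i => ?_
  have hF : Continuous fun M : Matrix m m ℂ => ‖h i * star M - 1‖ :=
    ((continuous_const.mul continuous_star).sub continuous_const).norm
  exact (hF.tendsto W).eventually_lt_const (hW i)

/-- ★★ **THE TANGENT MAP DEPENDS CONTINUOUSLY ON THE BASE POINT**: `W′ ↦ D K_{W′} = emlD h c W′` is continuous at every guarded `W`
(operator-norm topology) — the fixed-`h` slice of `HeightChiSqLEmlDContinuous.continuousOn_emlD` on the open domain `isOpen_emlDomain`. [folklore] -/
theorem continuousAt_emlD (h : ι → Matrix m m ℂ) (c : ι → ℝ) {W : Matrix m m ℂ} (hW : ∀ i, ‖h i * star W - 1‖ < 1) :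
    ContinuousAt (fun W' => emlD h c W') W := by
  have hmem : ((h, W) : (ι → Matrix m m ℂ) × Matrix m m ℂ) ∈
      {p : (ι → Matrix m m ℂ) × Matrix m m ℂ | ∀ i, ‖p.1 i * star p.2 - 1‖ < 1} := hW
  have hj : ContinuousAt (fun p : (ι → Matrix m m ℂ) × Matrix m m ℂ => emlD p.1 c p.2) (h, W) :=
    (continuousOn_emlD (m := m) (ι := ι) c).continuousAt ((isOpen_emlDomain (m := m) (ι := ι)).mem_nhds hmem)
  have he : ContinuousAt (fun W' : Matrix m m ℂ => ((h, W') : (ι → Matrix m m ℂ) × Matrix m m ℂ)) W :=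
    (continuous_const.prodMk continuous_id).continuousAt
  have hc := ContinuousAt.comp (g := fun p : (ι → Matrix m m ℂ) × Matrix m m ℂ => emlD p.1 c p.2)
    (f := fun W' : Matrix m m ℂ => ((h, W') : (ι → Matrix m m ℂ) × Matrix m m ℂ)) hj he
  exact hc

/-- **ε–r form**: for every `ε > 0` there is `r > 0` with `‖D K_{W′} − D K_W‖ ≤ ε` whenever `‖W′ − W‖ < r` — the oscillation control §1 consumes
(with `L` the tangent map at the window's centre and `λ = 1 − Σcᵢ` its floor in left-trivialised Hilbert–Schmidt form, g3's p612264). [folklore] -/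
theorem exists_ball_norm_emlD_sub_le (h : ι → Matrix m m ℂ) (c : ι → ℝ) {W : Matrix m m ℂ} (hW : ∀ i, ‖h i * star W - 1‖ < 1)
    {ε : ℝ} (hε : 0 < ε) :
    ∃ r > 0, ∀ W' ∈ ball W r, ‖emlD h c W' - emlD h c W‖ ≤ ε :=
  exists_ball_norm_sub_le (continuousAt_emlD h c hW) hε

omit [Nonempty m] in
/-- **The fibre map itself is continuous at guarded points** (indeed analytic). [folklore] -/
theorem continuousAt_kmat (h : ι → Matrix m m ℂ) (c : ι → ℝ) {W : Matrix m m ℂ} (hW : ∀ i, ‖h i * star W - 1‖ < 1) :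
    ContinuousAt (Kmat h c) W :=
  (analyticAt_kmat h c hW).continuousAt

/-- ★ **The LEFT-TRIVIALISED tangent maps vary continuously too**: `W′ ↦ (V ↦ K_{W′}* · D K_{W′} V)` is continuous at every guarded `W`
(operator-norm topology on `𝕄 →L[ℝ] 𝕄`). [folklore] -/
theorem continuousAt_leftTrivialised (h : ι → Matrix m m ℂ) (c : ι → ℝ) {W : Matrix m m ℂ} (hW : ∀ i, ‖h i * star W - 1‖ < 1) :
    ContinuousAt (fun W' => (ContinuousLinearMap.mul ℝ (Matrix m m ℂ) (star (Kmat h c W'))).comp (emlD h c W')) W := by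
  have h1 : ContinuousAt (fun W' => ContinuousLinearMap.mul ℝ (Matrix m m ℂ) (star (Kmat h c W'))) W :=
    (ContinuousLinearMap.mul ℝ (Matrix m m ℂ)).continuous.continuousAt.comp
      (continuous_star.continuousAt.comp (continuousAt_kmat h c hW))
  exact h1.clm_comp (continuousAt_emlD h c hW)

/-- **ε–r form for the left-trivialised tangent maps.** [folklore] -/
theorem exists_ball_norm_leftTrivialised_sub_le (h : ι → Matrix m m ℂ) (c : ι → ℝ) {W : Matrix m m ℂ}
    (hW : ∀ i, ‖h i * star W - 1‖ < 1) {ε : ℝ} (hε : 0 < ε) :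
    ∃ r > 0, ∀ W' ∈ ball W r,
      ‖(ContinuousLinearMap.mul ℝ (Matrix m m ℂ) (star (Kmat h c W'))).comp (emlD h c W')
        - (ContinuousLinearMap.mul ℝ (Matrix m m ℂ) (star (Kmat h c W))).comp (emlD h c W)‖ ≤ ε :=
  exists_ball_norm_sub_le (continuousAt_leftTrivialised h c hW) hε

end Smooth

end Summit.QuantumFields.YangMills.BalabanUVNodes.N08HaarCompatibilityGuardWindowInjective

end
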